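import Mathlib
import Literature.AlgebraicGeometry.Resolution.NonRationalChart
import Literature.AlgebraicGeometry.Resolution.VertexInitialForms
import HarnessLib

/-!
# The polygon at a non-rational near point: `α′ = δ − 1` and `d · β′ ≤ γ⁺`

Topic: `Literature/AlgebraicGeometry/Resolution`. The heart of the "hard part" of
Cossart–Piltant 2008, Lemma 4.5 (2) (pp. 12–13, (19)–(22)) / Cossart–Jannsen–Saito, LNM 2270,
Lemma 14.5: at a closed point `x′` of the exceptional divisor which is not rational over `x`,
`[k(x′) : k(x)] = d ≥ 2`, with parameters `(y′, u₁, φ′)`, the weak transform `J′` has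

  `α(J′) = δ(J) − 1`  and  `β(J′) ≤ γ⁺(J)/d`  (CJS Lemma 14.5: `γ⁺ ≥ d · β′`),

whence `β(J′) ≤ β(J)/d < β(J)` as soon as `β(J) > 0` (CoP1 (22): "the middle inequality in (22)
is strict since `deg G_i/i = β(x) > 0` … and `[k(x′):k(x)] > 1`"). In the expansion-free setting
of `NonRationalChart` (no preparedness: the bound is for the system `(y′, u₁, φ′)` itself; the
polygon of a `v`-prepared system is treated later) we PROVE (no facts):

* `facePoly` — the polynomials `G_b(T) = Σ C_{b,a} T^{a₂}` collecting the `δ`-face monomials of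
  a unit representative with `y`-degree `b` (CoP1 (19): `F = Z^μ + Σ Z^{μ−i} F_i(U₁, U₂)`,
  dehomogenised);
* `exists_pts_nr_face` — **realisation**: a Newton point of `J′` for `(y′, u₁, φ′)` with
  `spt₁′ + L = δs` and `d · spt₂′ ≤ γ⁺s` (transport of a fine unit representative, `φ′`-adic
  factorisation `G_b(t) = φ′^{s_b} v_b + u₁ r_b`, and a steep weight selecting the minimal
  `s_b/(μ − b)`);
* `alphaS_nr_add`, `mul_betaS_nr_le_gammaPlusS` — the laws.

## Sources

* V. Cossart, O. Piltant, J. Algebra 320 (2008), proof of Lemma 4.5, pp. 12–13, (19)–(22).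
  [CossartPiltant2008]
* V. Cossart, U. Jannsen, S. Saito, LNM 2270 (2020), Ch. 14, (14.3)–(14.12), Lemma 14.5.
  [CossartJannsenSaito2020]
-/

noncomputable section

open IsLocalRing MvPolynomial

namespace Literature.AlgebraicGeometry.Resolution

universe u

/-! ## Face polynomials -/

section FacePoly

variable {R : Type u} [CommRing R]

/-- The `δ`-face monomials of `y`-degree `b` of `F`: `m₀ = b < μ` and `spt₁ m + spt₂ m = δs`.
[cite: CossartPiltant2008, (19)] -/
def faceSet (F : MvPolynomial (Fin 3) R) (μ δs b : ℕ) : Finset (Fin 3 →₀ ℕ) :=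
  F.support.filter (fun m => m 0 = b ∧ m 0 < μ ∧ spt₁ μ m + spt₂ μ m = δs)

/-- Membership in the face set. [folklore] -/
theorem mem_faceSet {F : MvPolynomial (Fin 3) R} {μ δs b : ℕ} {m : Fin 3 →₀ ℕ} :
    m ∈ faceSet F μ δs b ↔ m ∈ F.support ∧ m 0 = b ∧ m 0 < μ ∧ spt₁ μ m + spt₂ μ m = δs := by
  rw [faceSet, Finset.mem_filter]

/-- On a face set, `m₁ + m₂` is constant: `(m₁ + m₂) · sfac = δs`. [folklore] -/
theorem add_mul_sfac_of_mem_faceSet {F : MvPolynomial (Fin 3) R} {μ δs b : ℕ} {m : Fin 3 →₀ ℕ}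
    (hm : m ∈ faceSet F μ δs b) : (m 1 + m 2) * sfac μ m = δs := by
  obtain ⟨-, -, -, h⟩ := mem_faceSet.mp hm
  rw [spt₁, spt₂] at h
  rw [add_mul]; exact h

/-- Two members of a face set with the same `m₂` coincide. [folklore] -/
theorem eq_of_mem_faceSet {F : MvPolynomial (Fin 3) R} {μ δs b : ℕ} {m m' : Fin 3 →₀ ℕ}
    (hm : m ∈ faceSet F μ δs b) (hm' : m' ∈ faceSet F μ δs b) (h2 : m 2 = m' 2) : m = m' := by
  have h0 : m 0 = m' 0 := by
    rw [(mem_faceSet.mp hm).2.1, (mem_faceSet.mp hm').2.1]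
  have hs : sfac μ m = sfac μ m' := by rw [sfac, sfac, h0]
  have hlt : m 0 < μ := (mem_faceSet.mp hm).2.2.1
  have hpos := sfac_pos hlt
  have hsum := add_mul_sfac_of_mem_faceSet hm
  have hsum' := add_mul_sfac_of_mem_faceSet hm'
  rw [← hs, ← hsum] at hsum'
  have h1 : m 1 + m 2 = m' 1 + m' 2 := Nat.eq_of_mul_eq_mul_right hpos hsum'.symm
  ext i
  fin_cases i
  · exact h0
  · simp only [Fin.mk_one]; omega
  · exact h2

/-- **The face polynomial** `G_b(T) = Σ_{m ∈ face_b} C_m T^{m₂}`. [cite: CossartPiltant2008, (19)–(20)] [cite: CossartJannsenSaito2020, (14.3)] -/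
def facePoly (F : MvPolynomial (Fin 3) R) (μ δs b : ℕ) : Polynomial R :=
  ∑ m ∈ faceSet F μ δs b, Polynomial.monomial (m 2) (F.coeff m)

/-- Coefficients of the face polynomial at the exponents of the face. [folklore] -/
theorem coeff_facePoly_of_mem {F : MvPolynomial (Fin 3) R} {μ δs b : ℕ} {m : Fin 3 →₀ ℕ}
    (hm : m ∈ faceSet F μ δs b) : (facePoly F μ δs b).coeff (m 2) = F.coeff m := by
  classical
  rw [facePoly, Polynomial.finsetSum_coeff, Finset.sum_eq_single m]
  · rw [Polynomial.coeff_monomial, if_pos rfl]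
  · intro m' hm' hne
    rw [Polynomial.coeff_monomial, if_neg]
    exact fun h => hne (eq_of_mem_faceSet hm' hm h)
  · intro h; exact absurd hm h

/-- Every nonzero coefficient of the face polynomial comes from the face. [folklore] -/
theorem exists_of_coeff_facePoly_ne_zero {F : MvPolynomial (Fin 3) R} {μ δs b n : ℕ}
    (h : (facePoly F μ δs b).coeff n ≠ 0) : ∃ m ∈ faceSet F μ δs b, m 2 = n := by
  classical
  rw [facePoly, Polynomial.finsetSum_coeff] at h
  obtain ⟨m, hm, hmn⟩ := Finset.exists_ne_zero_of_sum_ne_zero h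
  rw [Polynomial.coeff_monomial] at hmn
  by_cases h2 : m 2 = n
  · exact ⟨m, hm, h2⟩
  · rw [if_neg h2] at hmn; exact absurd rfl hmn

/-- The degree of the face polynomial is at most any bound on the `m₂` of the face. [folklore] -/
theorem natDegree_facePoly_le {F : MvPolynomial (Fin 3) R} {μ δs b A : ℕ}
    (hA : ∀ m ∈ faceSet F μ δs b, m 2 ≤ A) : (facePoly F μ δs b).natDegree ≤ A := by
  rw [Polynomial.natDegree_le_iff_coeff_eq_zero]
  intro n hn
  by_contra h
  obtain ⟨m, hm, hm2⟩ := exists_of_coeff_facePoly_ne_zero h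
  have := hA m hm
  omega

/-- Evaluation of the face polynomial. [folklore] -/
theorem eval₂_facePoly {R' : Type u} [CommRing R'] (φ : R →+* R') (t : R')
    (F : MvPolynomial (Fin 3) R) (μ δs b : ℕ) :
    Polynomial.eval₂ φ t (facePoly F μ δs b) =
      ∑ m ∈ faceSet F μ δs b, φ (F.coeff m) * t ^ (m 2) := by
  rw [facePoly, Polynomial.eval₂_finsetSum]
  refine Finset.sum_congr rfl fun m _ => ?_
  rw [Polynomial.eval₂_monomial]

/-- The reduction of the face polynomial of a polynomial with unit coefficients is nonzero as soon
as the face is nonempty. [folklore] -/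
theorem map_facePoly_ne_zero [IsLocalRing R] {F : MvPolynomial (Fin 3) R} (hFu : HasUnitCoeffs F)
    {μ δs b : ℕ} {m : Fin 3 →₀ ℕ} (hm : m ∈ faceSet F μ δs b) :
    Polynomial.map (residue R) (facePoly F μ δs b) ≠ 0 := by
  intro h
  have := congrArg (fun Q => Q.coeff (m 2)) h
  simp only [Polynomial.coeff_map, Polynomial.coeff_zero] at this
  rw [coeff_facePoly_of_mem hm, residue_eq_zero_iff] at this
  exact (mem_maximalIdeal _).mp this (hFu m (mem_faceSet.mp hm).1)

end FacePoly

/-! ## Realisation at a non-rational point -/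

/-- The exponent `(b, a, s)` (`y`-degree `b`, `u₁`-degree `a`, `φ′`-degree `s`) as a finitely
supported function. [folklore] -/
def ybexp (b a s : ℕ) : Fin 3 →₀ ℕ := Finsupp.equivFunOnFinite.symm ![b, a, s]

/-- Components of `ybexp`. [folklore] -/
@[simp] theorem ybexp_apply (b a s : ℕ) (i : Fin 3) : ybexp b a s i = ![b, a, s] i := rfl

/-- `monom3` of `ybexp`. [folklore] -/
theorem monom3_ybexp {S : Type*} [CommRing S] (c' : Fin 3 → S) (b a s : ℕ) :
    monom3 c' (ybexp b a s) = c' 0 ^ b * c' 1 ^ a * c' 2 ^ s := by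
  simp [monom3]

/-- The weight of `ybexp` for a level weight. [folklore] -/
theorem weight_levelWeight_ybexp (μ w₀ p₁ p₂ b a s : ℕ) :
    Finsupp.weight (levelWeight μ w₀ p₁ p₂) (ybexp b a s) = w₀ * b + μ.factorial * (p₁ * a + p₂ * s) := by
  rw [weight_levelWeight]; rfl

section Realize

variable {R R' : Type u} [CommRing R] [CommRing R'] (φ : R →+* R') {c : Fin 3 → R}
  {c' : Fin 3 → R'} (h₁ : c' 1 = φ (c 1)) (h₀ : φ (c 0) = φ (c 1) * c' 0) {t : R'}
  (ht : φ (c 2) = φ (c 1) * t) {P : Polynomial R} (hP : c' 2 = Polynomial.eval₂ φ t P)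
  [IsRegularLocalRing R] [IsRegularLocalRing R']
  (hgen : Ideal.span {c 0, c 1, c 2} = maximalIdeal R) (hdim : ringKrullDim R = 3)
  (hgen' : Ideal.span {c' 0, c' 1, c' 2} = maximalIdeal R') (hdim' : ringKrullDim R' = 3)
  (hres : ∀ G : Polynomial R, Polynomial.eval₂ φ t G ∈ maximalIdeal R' ↔
    Polynomial.map (residue R) P ∣ Polynomial.map (residue R) G)
  {J : Ideal R} {μ : ℕ}

local notation "J'" => Submodule.colon (Ideal.map φ J) ({φ (c 1) ^ μ} : Set R')

include h₁ h₀ ht hP hgen hdim hgen' hdim' hres in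
/-- **Realisation at a non-rational point** (CoP1 (20)–(22); CJS (14.10)–(14.12), Lemma 14.5):
if `J ⊆ 𝔪^μ` has `δ > 1` and `P̄` is not a unit, then the weak transform `J′ = (J R′ : (φ u₁)^μ)`
has a Newton point `e′` for `(y′, u₁, φ′)` with `spt₁ e′ + L = δs` and `d · spt₂ e′ ≤ γ⁺s`.
[cite: CossartPiltant2008, proof of Lemma 4.5, (20)–(22)] [cite: CossartJannsenSaito2020, Lemma 14.5] -/
theorem exists_pts_nr_face (hPu : ¬ IsUnit (Polynomial.map (residue R) P))
    (hd : 1 ≤ (Polynomial.map (residue R) P).natDegree)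
    (hJμ : J ≤ maximalIdeal R ^ μ) (hne : (pts c J μ).Nonempty) (hδ : μ.factorial < deltaS c J μ) :
    ∃ e' ∈ pts c' J' μ, spt₁ μ e' + μ.factorial = deltaS c J μ ∧
      (Polynomial.map (residue R) P).natDegree * spt₂ μ e' ≤ gammaPlusS c J μ := by
  classical
  -- notation
  set δs := deltaS c J μ with hδs
  set Γ := gammaPlusS c J μ with hΓ
  have hgenr := span_range_eq_of_span_triple c hgen
  have hgenr' := span_range_eq_of_span_triple c' hgen'
  have hδpos : 0 < δs := by omega
  -- the face weight on `R`
  set w : Fin 3 → ℕ := levelWeight μ δs 1 1 with hwdef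
  have hw : ∀ i, 0 < w i := levelWeight_pos hδpos Nat.one_pos Nat.one_pos
  have hJw : J ≤ weightedIdealW c w (δs * μ) :=
    (le_weightedIdealW_levelWeight_iff c hgen hdim J hδpos Nat.one_pos Nat.one_pos).mpr
      (fun e he => by simpa using deltaS_le he)
  -- an element `f ∈ J` with a face term
  obtain ⟨eδ, heδ, hsumδ⟩ := exists_pts_deltaS hne
  have hminδ : ∀ x ∈ pts c J μ, 1 * spt₁ μ eδ + 1 * spt₂ μ eδ ≤ 1 * spt₁ μ x + 1 * spt₂ μ x := by
    intro x hx; simpa [hsumδ] using deltaS_le hx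
  obtain ⟨f, hfJ, hinitδ⟩ := exists_isInitialTerm_levelWeight_of_isMinOn c hgen hdim Nat.one_pos
    Nat.one_pos heδ hminδ (by simpa [hsumδ] using hδpos)
  have hwδ : levelWeight μ (1 * spt₁ μ eδ + 1 * spt₂ μ eδ) 1 1 = w := by
    rw [hwdef]; congr 1; simpa using hsumδ
  rw [hwδ] at hinitδ
  -- constants: steepness `Ñ`, a bound `Λ` for all levels, precision `M`
  set Ntil := Γ * μ + 1 with hNtil
  set Λ := (Ntil * δs + Γ) * μ with hΛ
  set M := Λ + μ + 1 with hM
  -- a fine unit representative of `f`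
  obtain ⟨F, hFu, -, hFrem⟩ := exists_unitRep c hgenr f M
  have hremw : f - eval c F ∈ weightedIdealW c w M := pow_maximalIdeal_le_weightedIdealW c hgenr hw M hFrem
  have hrem1 : f - eval c F ∈ weightedIdealW c (fun _ => 1) M :=
    pow_maximalIdeal_le_weightedIdealW c hgenr (fun _ => Nat.one_pos) M hFrem
  have hδμΛ : δs * μ ≤ Λ := by
    rw [hΛ]
    have : δs ≤ Ntil * δs + Γ := by
      have : 1 * δs ≤ Ntil * δs := Nat.mul_le_mul_right _ (by omega)
      omega
    exact Nat.mul_le_mul_right _ this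
  -- (a) all monomials of `F` have degree `≥ μ`
  have hdeg : ∀ m ∈ F.support, μ ≤ m 0 + m 1 + m 2 := by
    have hf1 : f ∈ weightedIdealW c (fun _ => 1) μ := by rw [weightedIdealW_one_eq_pow c hgenr]; exact hJμ hfJ
    intro m hm
    have := (mem_weightedIdealW_iff_of_unitRep c hgen hdim (fun _ => Nat.one_pos) hFu hrem1 (by omega)).mp
      hf1 m hm
    rwa [weight_one_eq] at this
  -- (b) all monomials of `F` have `w`-weight `≥ δs μ`; those with `m₀ < μ` satisfy `spt₁ + spt₂ ≥ δs`
  have hminw : ∀ m ∈ F.support, δs * μ ≤ Finsupp.weight w m :=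
    (mem_weightedIdealW_iff_of_unitRep c hgen hdim hw hFu hremw (by omega)).mp (hJw hfJ)
  have hface_ge : ∀ m ∈ F.support, m 0 < μ → δs ≤ spt₁ μ m + spt₂ μ m := by
    intro m hm hm0
    have := (le_weight_levelWeight_iff hm0 δs 1 1).mp (hminw m hm)
    simpa using this
  -- (c) face monomials are Newton points: `spt₂ ≤ Γ`
  have hface_pts : ∀ m ∈ F.support, m 0 < μ → spt₁ μ m + spt₂ μ m = δs → m ∈ pts c J μ := by
    intro m hm hm0 hsum
    have hwt : Finsupp.weight w m = δs * μ := by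
      rw [hwdef, (weight_levelWeight_eq_iff_spt hm0 δs 1 1).mpr (by simpa using hsum)]
    have hinit : IsInitialTerm c w f m := by
      refine (isInitialTerm_iff_of_unitRep c hgen hdim hw hFu hremw (by omega)).mpr ⟨hm, ?_⟩
      intro m' hm'; rw [hwt]; exact hminw m' hm'
    exact ⟨mem_occ_of_isInitialTerm c hfJ hw hinit, hm0⟩
  have hface_Γ : ∀ b, ∀ m ∈ faceSet F μ δs b, spt₂ μ m ≤ Γ := by
    intro b m hm
    obtain ⟨hms, -, hm0, hsum⟩ := mem_faceSet.mp hm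
    exact le_gammaPlusS (hface_pts m hms hm0 hsum) hsum
  -- the face of `eδ` is nonempty
  have hwteδ : Finsupp.weight w eδ = δs * μ := by
    rw [hwdef]; exact (weight_levelWeight_eq_iff_spt heδ.2 δs 1 1).mpr (by simpa using hsumδ)
  have heδF : eδ ∈ F.support :=
    ((isInitialTerm_iff_of_unitRep c hgen hdim hw hFu hremw (by omega)).mp hinitδ).1
  have heδface : eδ ∈ faceSet F μ δs (eδ 0) := mem_faceSet.mpr ⟨heδF, rfl, heδ.2, hsumδ⟩
  -- the set of `b`'s with nonempty face, and the factorisation data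
  set Bs : Finset ℕ := (Finset.range μ).filter (fun b => (faceSet F μ δs b).Nonempty) with hBs
  have hBs_ne : Bs.Nonempty := ⟨eδ 0, Finset.mem_filter.mpr ⟨Finset.mem_range.mpr heδ.2, eδ, heδface⟩⟩
  have hfac : ∀ b ∈ Bs, ∃ (s : ℕ) (v r : R'), IsUnit v ∧
      Polynomial.eval₂ φ t (facePoly F μ δs b) = c' 2 ^ s * v + φ (c 1) * r ∧
      s * (Polynomial.map (residue R) P).natDegree ≤
        (Polynomial.map (residue R) (facePoly F μ δs b)).natDegree := by
    intro b hb
    obtain ⟨-, m, hm⟩ := Finset.mem_filter.mp hb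
    exact exists_pow_mul_unit_add φ hgen h₀ ht hP hres hPu (map_facePoly_ne_zero hFu hm)
  choose! sOf vOf rOf hvOf hevalOf hsdOf using hfac
  -- the scaled `spt₂`-value of the candidate of `b`: `s_b · sfac_b`
  let val : ℕ → ℕ := fun b => sOf b * (μ.factorial / (μ - b))
  obtain ⟨bst, hbst, hbmin⟩ := Finset.exists_min_image Bs val hBs_ne
  obtain ⟨hbst_lt', mst, hmst⟩ := Finset.mem_filter.mp hbst
  have hbst_lt : bst < μ := Finset.mem_range.mp hbst_lt'
  set mstar := val bst with hmstar
  -- face members of `b`: a chosen one, the common `u₁`-exponent `aOf b`, the bound `val b ≤ Γ`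
  have hmem_ex : ∀ b ∈ Bs, ∃ m, m ∈ faceSet F μ δs b := fun b hb => (Finset.mem_filter.mp hb).2
  choose! mOf hmOf using hmem_ex
  have hL : ∀ {m : Fin 3 →₀ ℕ}, m 0 < μ → (μ - m 0) * sfac μ m = μ.factorial := fun hm => sub_mul_sfac hm
  -- all members of a face have the same `m₁ + m₂`
  have hsame : ∀ b ∈ Bs, ∀ m ∈ faceSet F μ δs b, m 1 + m 2 = mOf b 1 + mOf b 2 := by
    intro b hb m hm
    have hm' := hmOf b hb
    have h0 : m 0 = mOf b 0 := by rw [(mem_faceSet.mp hm).2.1, (mem_faceSet.mp hm').2.1]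
    have hs : sfac μ m = sfac μ (mOf b) := by rw [sfac, sfac, h0]
    have hsum := add_mul_sfac_of_mem_faceSet hm
    have hsum' := add_mul_sfac_of_mem_faceSet hm'
    rw [← hs, ← hsum] at hsum'
    exact Nat.eq_of_mul_eq_mul_right (sfac_pos (mem_faceSet.mp hm).2.2.1) hsum'.symm
  -- `m₁ + m₂ > μ − b` on a face (since `δs > L`)
  have hbig : ∀ b ∈ Bs, μ - b < mOf b 1 + mOf b 2 := by
    intro b hb
    have hm := hmOf b hb
    obtain ⟨-, hb0, hlt, -⟩ := mem_faceSet.mp hm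
    have hsum := add_mul_sfac_of_mem_faceSet hm
    have hLb := hL hlt
    rw [hb0] at hLb
    by_contra hle
    push Not at hle
    have := Nat.mul_le_mul_right (sfac μ (mOf b)) hle
    rw [hLb, hsum] at this
    omega
  let aOf : ℕ → ℕ := fun b => mOf b 1 + mOf b 2 - (μ - b)
  -- key identities: `L · aOf b = (μ − b)(δs − L)` and `(μ − b) · val b = L · sOf b`
  have haOf : ∀ b ∈ Bs, μ.factorial * aOf b = (μ - b) * (δs - μ.factorial) := by
    intro b hb
    have hm := hmOf b hb
    obtain ⟨-, hb0, hlt, -⟩ := mem_faceSet.mp hm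
    have hsum := add_mul_sfac_of_mem_faceSet hm
    have hLb := hL hlt
    rw [hb0] at hLb
    have hbg := hbig b hb
    -- `L (m₁+m₂) = (μ-b) δs`
    have h1 : μ.factorial * (mOf b 1 + mOf b 2) = (μ - b) * δs := by
      rw [← hLb, ← hsum]; ring
    show μ.factorial * (mOf b 1 + mOf b 2 - (μ - b)) = (μ - b) * (δs - μ.factorial)
    rw [Nat.mul_sub, h1, mul_comm (μ.factorial) (μ - b), ← Nat.mul_sub]
  have hval : ∀ b ∈ Bs, (μ - b) * val b = μ.factorial * sOf b := by
    intro b hb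
    have hm := hmOf b hb
    obtain ⟨-, hb0, hlt, -⟩ := mem_faceSet.mp hm
    have hLb := hL hlt
    rw [hb0] at hLb
    show (μ - b) * (sOf b * (μ.factorial / (μ - b))) = μ.factorial * sOf b
    have : μ.factorial / (μ - b) = sfac μ (mOf b) := by rw [sfac, hb0]
    rw [this, ← hLb]; ring
  -- `d · val b ≤ Γ`: `s d ≤ deg Ḡ_b ≤ A_b = max m₂`, and `A_b · sfac ≤ Γ` on the face
  have hvalΓd : ∀ b ∈ Bs, (Polynomial.map (residue R) P).natDegree * val b ≤ Γ := by
    intro b hb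
    obtain ⟨mx, hmx, hmxmax⟩ := Finset.exists_max_image (faceSet F μ δs b) (fun m => m 2) ⟨_, hmOf b hb⟩
    have hdeg : (Polynomial.map (residue R) (facePoly F μ δs b)).natDegree ≤ mx 2 :=
      (Polynomial.natDegree_map_le).trans (natDegree_facePoly_le hmxmax)
    have hs : (Polynomial.map (residue R) P).natDegree * sOf b ≤ mx 2 := by
      rw [mul_comm]; exact (hsdOf b hb).trans hdeg
    obtain ⟨-, hb0, hlt, -⟩ := mem_faceSet.mp hmx
    have hΓmx : spt₂ μ mx ≤ Γ := hface_Γ b mx hmx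
    rw [spt₂] at hΓmx
    have hsf : μ.factorial / (μ - b) = sfac μ mx := by rw [sfac, hb0]
    show (Polynomial.map (residue R) P).natDegree * (sOf b * (μ.factorial / (μ - b))) ≤ Γ
    rw [hsf, ← mul_assoc]
    exact (Nat.mul_le_mul_right _ hs).trans hΓmx
  have hvalΓ : ∀ b ∈ Bs, val b ≤ Γ := by
    intro b hb
    have := hvalΓd b hb
    have h1 : 1 * val b ≤ (Polynomial.map (residue R) P).natDegree * val b := Nat.mul_le_mul_right _ hd
    omega
  have hmstarΓ : mstar ≤ Γ := hvalΓ bst hbst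
  have hNtil_gt : mstar + 1 ≤ Ntil := by
    rw [hNtil]
    have : mstar ≤ Γ * μ := by
      have hμ : 1 ≤ μ := by have := heδ.2; omega
      calc mstar ≤ Γ := hmstarΓ
        _ = Γ * 1 := (mul_one _).symm
        _ ≤ Γ * μ := Nat.mul_le_mul_left _ hμ
    omega
  -- the steep weight on `R′`
  set w0' := Ntil * (δs - μ.factorial) + mstar with hw0'
  set w' : Fin 3 → ℕ := levelWeight μ w0' Ntil 1 with hw'def
  have hw0'pos : 0 < w0' := by
    rw [hw0']
    have : 1 ≤ δs - μ.factorial := by omega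
    have : 1 * 1 ≤ Ntil * (δs - μ.factorial) := Nat.mul_le_mul (by omega) this
    omega
  have hw' : ∀ i, 0 < w' i := levelWeight_pos hw0'pos (by omega) Nat.one_pos
  set ℓ := w0' * μ with hℓ
  set T := ℓ + 1 + μ * (μ.factorial * Ntil) with hT
  have hwt' : ∀ e : Fin 3 →₀ ℕ, Finsupp.weight w' e = w0' * e 0 + μ.factorial * (Ntil * e 1 + 1 * e 2) :=
    fun e => weight_levelWeight μ w0' Ntil 1 e
  -- the candidate exponents `e_b = (b, aOf b, sOf b)` and their weights
  let eOf : ℕ → Fin 3 →₀ ℕ := fun b => ybexp b (aOf b) (sOf b)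
  have hweOf : ∀ b ∈ Bs, Finsupp.weight w' (eOf b) + (μ - b) * mstar = ℓ + (μ - b) * val b := by
    intro b hb
    have hb_lt : b < μ := Finset.mem_range.mp (Finset.mem_filter.mp hb).1
    have h1 := haOf b hb
    have h2 := hval b hb
    rw [hwt' (eOf b)]
    simp only [eOf, ybexp_apply, Matrix.cons_val_zero, Matrix.cons_val_one, Matrix.cons_val_two,
      Matrix.head_cons, Matrix.tail_cons, one_mul]
    -- `w0' b + L Ntil aOf + L s + (μ-b) mstar = w0' μ + (μ-b) val`
    have key : w0' * b + μ.factorial * (Ntil * aOf b + sOf b) + (μ - b) * mstar =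
        w0' * b + Ntil * (μ.factorial * aOf b) + μ.factorial * sOf b + (μ - b) * mstar := by ring
    rw [key, h1, ← h2, hℓ]
    have hsplit : w0' * μ = w0' * b + w0' * (μ - b) := by
      rw [← Nat.mul_add]; congr 1; omega
    rw [hsplit, hw0']
    ring
  have hweOf_ge : ∀ b ∈ Bs, ℓ ≤ Finsupp.weight w' (eOf b) := by
    intro b hb
    have := hweOf b hb
    have hmin := hbmin b hb
    have : (μ - b) * mstar ≤ (μ - b) * val b := Nat.mul_le_mul_left _ hmin
    omega
  have hweOf_eq : ∀ b ∈ Bs, val b = mstar → Finsupp.weight w' (eOf b) = ℓ := by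
    intro b hb hv
    have := hweOf b hb
    rw [hv] at this
    omega
  have hweOf_gt : ∀ b ∈ Bs, val b ≠ mstar → ℓ + 1 ≤ Finsupp.weight w' (eOf b) := by
    intro b hb hv
    have hb_lt : b < μ := Finset.mem_range.mp (Finset.mem_filter.mp hb).1
    have := hweOf b hb
    have hmin := hbmin b hb
    have hlt : mstar + 1 ≤ val b := by omega
    have : (μ - b) * (mstar + 1) ≤ (μ - b) * val b := Nat.mul_le_mul_left _ hlt
    rw [Nat.mul_add, mul_one] at this
    have hμb : 1 ≤ μ - b := by omega
    omega
  -- junk weights: `(b, aOf b + 1 + μ, 0)` has weight `≥ T`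
  have hjunk : ∀ b ∈ Bs, T ≤ Finsupp.weight w' (ybexp b (aOf b + 1 + μ) 0) := by
    intro b hb
    have hb_lt : b < μ := Finset.mem_range.mp (Finset.mem_filter.mp hb).1
    have h1 := haOf b hb
    rw [hwt']
    simp only [ybexp_apply, Matrix.cons_val_zero, Matrix.cons_val_one, Matrix.cons_val_two,
      Matrix.head_cons, Matrix.tail_cons, mul_zero, add_zero]
    rw [hT, hℓ, hw0']
    -- expand and compare
    have hkey : μ.factorial * (Ntil * (aOf b + 1 + μ)) =
        Ntil * (μ.factorial * aOf b) + μ.factorial * Ntil + μ * (μ.factorial * Ntil) := by ring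
    rw [hkey, h1]
    -- need: `(Ntil(δs-L)+mstar) μ + 1 ≤ (Ntil(δs-L)+mstar) b + Ntil (μ-b)(δs-L) + L Ntil`
    have hA : (Ntil * (δs - μ.factorial) + mstar) * μ =
        (Ntil * (δs - μ.factorial) + mstar) * b + Ntil * ((μ - b) * (δs - μ.factorial)) + (μ - b) * mstar := by
      have hsplit : (Ntil * (δs - μ.factorial) + mstar) * μ =
          (Ntil * (δs - μ.factorial) + mstar) * b + (Ntil * (δs - μ.factorial) + mstar) * (μ - b) := by
        rw [← Nat.mul_add]; congr 1; omega
      rw [hsplit]; ring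
    rw [hA]
    have hB : (μ - b) * mstar + 1 ≤ μ.factorial * Ntil := by
      have h3 : (μ - b) * mstar ≤ μ * mstar := Nat.mul_le_mul_right _ (Nat.sub_le _ _)
      have h4 : μ * mstar + 1 ≤ Ntil := by
        rw [hNtil]; have := Nat.mul_le_mul_left μ hmstarΓ; rw [mul_comm] at this
        have : μ * mstar ≤ Γ * μ := by rw [mul_comm Γ]; exact Nat.mul_le_mul_left μ hmstarΓ
        omega
      have h5 : Ntil ≤ μ.factorial * Ntil := Nat.le_mul_of_pos_left _ (Nat.factorial_pos μ)
      omega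
    omega
  -- non-face monomials with `m₀ < μ`: weight of `nrExp m` is `≥ T`
  have hnonface : ∀ m ∈ F.support, m 0 < μ → spt₁ μ m + spt₂ μ m ≠ δs →
      T ≤ Finsupp.weight w' (nrExp m) := by
    intro m hm hm0 hsum
    have hge : δs + 1 ≤ spt₁ μ m + spt₂ μ m := by
      have := hface_ge m hm hm0; omega
    have hLb := hL hm0
    rw [hwt']
    simp only [nrExp_apply_zero, nrExp_apply_one, nrExp_apply_two, mul_zero, add_zero]
    rw [hT, hℓ, hw0']
    -- `L (m₁+m₂) = (μ-b) sfac (m₁+m₂) ≥ (μ-b)(δs+1)`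
    have hsum1 : (μ - m 0) * (δs + 1) ≤ μ.factorial * (m 1 + m 2) := by
      rw [← hLb, mul_assoc]
      refine Nat.mul_le_mul_left _ ?_
      rw [Nat.mul_comm, add_mul, ← spt₁, ← spt₂]; exact hge
    have hkey : μ.factorial * (Ntil * (m 0 + m 1 + m 2)) =
        Ntil * (μ.factorial * m 0) + Ntil * (μ.factorial * (m 1 + m 2)) := by ring
    rw [hkey]
    have hA : (Ntil * (δs - μ.factorial) + mstar) * μ + 1 + μ * (μ.factorial * Ntil) =
        (Ntil * (δs - μ.factorial) + mstar) * m 0 + Ntil * ((μ - m 0) * (δs - μ.factorial)) +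
          (μ - m 0) * mstar + 1 + Ntil * (μ.factorial * m 0) + Ntil * ((μ - m 0) * μ.factorial) := by
      have hsplit : (Ntil * (δs - μ.factorial) + mstar) * μ =
          (Ntil * (δs - μ.factorial) + mstar) * m 0 + (Ntil * (δs - μ.factorial) + mstar) * (μ - m 0) := by
        rw [← Nat.mul_add]; congr 1; omega
      have hsplit' : μ * (μ.factorial * Ntil) = m 0 * (μ.factorial * Ntil) + (μ - m 0) * (μ.factorial * Ntil) := by
        rw [← Nat.add_mul]; congr 1; omega
      rw [hsplit, hsplit']; ring
    rw [hA]
    have hB : Ntil * ((μ - m 0) * (δs + 1)) ≤ Ntil * (μ.factorial * (m 1 + m 2)) :=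
      Nat.mul_le_mul_left _ hsum1
    have hC : Ntil * ((μ - m 0) * (δs - μ.factorial)) + Ntil * ((μ - m 0) * μ.factorial) + Ntil * (μ - m 0) =
        Ntil * ((μ - m 0) * (δs + 1)) := by
      have : δs = (δs - μ.factorial) + μ.factorial := by omega
      conv_rhs => rw [this]
      ring
    have hD : (μ - m 0) * mstar + 1 ≤ Ntil * (μ - m 0) := by
      have h4 : (μ - m 0) * (mstar + 1) ≤ (μ - m 0) * Ntil := Nat.mul_le_mul_left _ hNtil_gt
      rw [Nat.mul_add, mul_one] at h4
      have : 1 ≤ μ - m 0 := by omega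
      rw [mul_comm Ntil]; omega
    omega
  -- monomials with `m₀ ≥ μ` other than `(μ, 0, 0)`: weight `≥ T`
  have hhigh : ∀ m ∈ F.support, μ ≤ m 0 → m ≠ Finsupp.single 0 μ → T ≤ Finsupp.weight w' (nrExp m) := by
    intro m hm hm0 hne
    have hdegm := hdeg m hm
    have hgt : μ + 1 ≤ m 0 + m 1 + m 2 := by
      by_contra hle
      push Not at hle
      apply hne
      ext i
      fin_cases i
      · simp; omega
      · simp; omega
      · simp; omega
    rw [hwt']
    simp only [nrExp_apply_zero, nrExp_apply_one, nrExp_apply_two, mul_zero, add_zero]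
    rw [hT, hℓ]
    have h1 : w0' * μ ≤ w0' * m 0 := Nat.mul_le_mul_left _ hm0
    have h2 : μ.factorial * (Ntil * (μ + 1)) ≤ μ.factorial * (Ntil * (m 0 + m 1 + m 2)) :=
      Nat.mul_le_mul_left _ (Nat.mul_le_mul_left _ hgt)
    have h3 : μ.factorial * (Ntil * (μ + 1)) = μ * (μ.factorial * Ntil) + μ.factorial * Ntil := by ring
    have h4 : 1 ≤ μ.factorial * Ntil := Nat.mul_pos (Nat.factorial_pos μ) (by omega)
    omega
  -- the element `g` of the weak transform
  obtain ⟨g, hg⟩ := exists_eq_pow_mul_of_mem_pow φ (c' := ![c' 0, c' 1, t]) (by simpa using h₀)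
    (by simpa using ht) hgen (hJμ hfJ)
  have hgJ' : g ∈ J' := by
    rw [Submodule.mem_colon_singleton, smul_eq_mul, mul_comm, ← hg]; exact Ideal.mem_map_of_mem _ hfJ
  -- the polynomial `F⋆`
  set Fst : MvPolynomial (Fin 3) R' :=
    (∑ b ∈ Bs, if val b = mstar then monomial (eOf b) (vOf b) else 0) +
      monomial (Finsupp.single 0 μ) (φ (F.coeff (Finsupp.single 0 μ))) with hFst
  have hwt_single0 : Finsupp.weight w' (Finsupp.single 0 μ) = ℓ := by
    rw [Finsupp.weight_apply, Finsupp.sum_single_index (by simp), smul_eq_mul, hℓ, mul_comm]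
    simp [hw'def]
  have hFst_hom : Fst.IsWeightedHomogeneous w' ℓ := by
    refine IsWeightedHomogeneous.add (IsWeightedHomogeneous.sum _ _ _ fun b hb => ?_)
      (isWeightedHomogeneous_monomial _ _ _ hwt_single0)
    by_cases hv : val b = mstar
    · rw [if_pos hv]; exact isWeightedHomogeneous_monomial _ _ _ (hweOf_eq b hb hv)
    · rw [if_neg hv]; exact isWeightedHomogeneous_zero _ _ _
  have heOf_inj : ∀ b b', eOf b = eOf b' → b = b' := fun b b' h => by
    have := congrArg (fun e => e 0) h; simpa [eOf] using this
  have hFst_coeff : Fst.coeff (eOf bst) = vOf bst := by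
    rw [hFst, coeff_add, coeff_sum, coeff_monomial, if_neg, add_zero]
    · rw [Finset.sum_eq_single bst]
      · rw [if_pos hmstar.symm, coeff_monomial, if_pos rfl]
      · intro b _ hne
        by_cases hv : val b = mstar
        · rw [if_pos hv, coeff_monomial, if_neg (fun h => hne (heOf_inj _ _ h))]
        · rw [if_neg hv, coeff_zero]
      · intro h; exact absurd hbst h
    · intro h
      have := congrArg (fun e => e 0) h
      simp [eOf] at this
      omega
  -- the threshold ideal and its basic members
  have hmon_mem : ∀ e : Fin 3 →₀ ℕ, ∀ x y : R', T ≤ Finsupp.weight w' e →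
      x * monom3 c' e * y ∈ weightedIdealW c' w' T := by
    intro e x y he
    exact Ideal.mul_mem_right _ _ (Ideal.mul_mem_left _ _
      (weightedIdealW_antitone c' w' he (monomial_mem_weightedIdealW c' w' le_rfl)))
  -- the terms of `φ(F(c))`
  let term : (Fin 3 →₀ ℕ) → R' := fun m => φ (F.coeff m) * monom3 c' (nrExp m) * t ^ (m 2)
  have hφF : φ (eval c F) = ∑ m ∈ F.support, term m := by
    conv_lhs => rw [F.as_sum, map_sum, map_sum]
    refine Finset.sum_congr rfl fun m _ => ?_
    rw [eval_monomial_eq_monom3, map_mul, map_monom3_nr φ h₁ h₀ ht]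
    show _ = φ (F.coeff m) * monom3 c' (nrExp m) * t ^ (m 2)
    ring
  let face : (Fin 3 →₀ ℕ) → Prop := fun m => m 0 < μ ∧ spt₁ μ m + spt₂ μ m = δs
  have hfib : ∀ b, (F.support.filter face).filter (fun m => m 0 = b) = faceSet F μ δs b := by
    intro b
    ext m
    simp only [Finset.mem_filter, faceSet, face]
    tauto
  have hmaps : ∀ m ∈ F.support.filter face, m 0 ∈ Bs := by
    intro m hm
    obtain ⟨hms, hm0, hsum⟩ := Finset.mem_filter.mp hm
    refine Finset.mem_filter.mpr ⟨Finset.mem_range.mpr hm0, m, mem_faceSet.mpr ⟨hms, rfl, hm0, hsum⟩⟩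
  -- (P2) the face of `b`
  have hnrExp_face : ∀ b ∈ Bs, ∀ m ∈ faceSet F μ δs b, nrExp m = ybexp b (aOf b + μ) 0 := by
    intro b hb m hm
    have hs := hsame b hb m hm
    have hbg := hbig b hb
    obtain ⟨-, hb0, hlt, -⟩ := mem_faceSet.mp hm
    ext i
    fin_cases i
    · simpa using hb0
    · show m 0 + m 1 + m 2 = mOf b 1 + mOf b 2 - (μ - b) + μ
      omega
    · rfl
  have hP2 : ∀ b ∈ Bs, (∑ m ∈ faceSet F μ δs b, term m) -
      φ (c 1) ^ μ * eval c' (if val b = mstar then monomial (eOf b) (vOf b) else 0) ∈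
        weightedIdealW c' w' T := by
    intro b hb
    -- `Σ_face term = M_b · G_b(t) = M_b (φ′^s v + u₁ r)`
    have hsum : (∑ m ∈ faceSet F μ δs b, term m) =
        monom3 c' (ybexp b (aOf b + μ) 0) * Polynomial.eval₂ φ t (facePoly F μ δs b) := by
      rw [eval₂_facePoly, Finset.mul_sum]
      refine Finset.sum_congr rfl fun m hm => ?_
      show φ (F.coeff m) * monom3 c' (nrExp m) * t ^ (m 2) = _
      rw [hnrExp_face b hb m hm]; ring
    have hMb : monom3 c' (ybexp b (aOf b + μ) 0) * c' 2 ^ sOf b = φ (c 1) ^ μ * monom3 c' (eOf b) := by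
      simp only [eOf, monom3_ybexp, pow_zero, mul_one, ← h₁]; ring
    rw [hsum, hevalOf b hb, mul_add, ← mul_assoc, hMb]
    have hjunk_mem : monom3 c' (ybexp b (aOf b + μ) 0) * (φ (c 1) * rOf b) ∈ weightedIdealW c' w' T := by
      have : monom3 c' (ybexp b (aOf b + μ) 0) * (φ (c 1) * rOf b) =
          1 * monom3 c' (ybexp b (aOf b + 1 + μ) 0) * rOf b := by
        simp only [monom3_ybexp, pow_zero, mul_one, ← h₁, one_mul]; ring
      rw [this]; exact hmon_mem _ _ _ (hjunk b hb)
    by_cases hv : val b = mstar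
    · rw [if_pos hv, eval_monomial_eq_monom3]
      have : φ (c 1) ^ μ * monom3 c' (eOf b) * vOf b + monom3 c' (ybexp b (aOf b + μ) 0) * (φ (c 1) * rOf b) -
          φ (c 1) ^ μ * (vOf b * monom3 c' (eOf b)) =
          monom3 c' (ybexp b (aOf b + μ) 0) * (φ (c 1) * rOf b) := by ring
      rw [this]; exact hjunk_mem
    · rw [if_neg hv, map_zero, mul_zero, sub_zero]
      refine Ideal.add_mem _ ?_ hjunk_mem
      have hmon : φ (c 1) ^ μ * monom3 c' (eOf b) = monom3 c' (eOf b + Finsupp.single 1 μ) := by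
        rw [monom3_add]; simp [monom3, h₁]; ring
      rw [hmon]
      have : monom3 c' (eOf b + Finsupp.single 1 μ) * vOf b = 1 * monom3 c' (eOf b + Finsupp.single 1 μ) * vOf b := by
        ring
      rw [this]
      refine hmon_mem _ _ _ ?_
      rw [map_add, Finsupp.weight_apply w' (Finsupp.single 1 μ), Finsupp.sum_single_index (by simp),
        smul_eq_mul]
      have := hweOf_gt b hb hv
      have hw'1 : w' 1 = μ.factorial * Ntil := by simp [hw'def]
      rw [hw'1, hT]
      omega
  -- (P1) the non-face terms
  have hP1 : (∑ m ∈ F.support.filter (fun m => ¬ face m), term m) -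
      φ (c 1) ^ μ * eval c' (monomial (Finsupp.single 0 μ) (φ (F.coeff (Finsupp.single 0 μ)))) ∈
        weightedIdealW c' w' T := by
    have hterm0 : φ (c 1) ^ μ * eval c' (monomial (Finsupp.single 0 μ) (φ (F.coeff (Finsupp.single 0 μ)))) =
        term (Finsupp.single 0 μ) := by
      show _ = φ (F.coeff (Finsupp.single 0 μ)) * monom3 c' (nrExp (Finsupp.single 0 μ)) * t ^ ((Finsupp.single 0 μ : Fin 3 →₀ ℕ) 2)
      rw [eval_monomial_eq_monom3]
      have hn : nrExp (Finsupp.single 0 μ) = Finsupp.single 0 μ + Finsupp.single 1 μ := by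
        ext i; fin_cases i <;> simp
      rw [hn, monom3_add]
      simp [monom3, h₁]; ring
    have hothers : ∀ m ∈ F.support.filter (fun m => ¬ face m), m ≠ Finsupp.single 0 μ →
        term m ∈ weightedIdealW c' w' T := by
      intro m hm hne
      obtain ⟨hms, hnf⟩ := Finset.mem_filter.mp hm
      show φ (F.coeff m) * monom3 c' (nrExp m) * t ^ (m 2) ∈ _
      refine hmon_mem _ _ _ ?_
      by_cases hm0 : m 0 < μ
      · exact hnonface m hms hm0 (fun h => hnf ⟨hm0, h⟩)
      · exact hhigh m hms (by omega) hne
    rw [hterm0]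
    by_cases hμ0 : Finsupp.single 0 μ ∈ F.support.filter (fun m => ¬ face m)
    · rw [← Finset.sum_erase_add _ _ hμ0, add_sub_cancel_right]
      exact Ideal.sum_mem _ fun m hm =>
        hothers m (Finset.mem_of_mem_erase hm) (Finset.ne_of_mem_erase hm)
    · have h0 : term (Finsupp.single 0 μ) = 0 := by
        have hns : Finsupp.single 0 μ ∉ F.support := by
          intro h; apply hμ0
          refine Finset.mem_filter.mpr ⟨h, ?_⟩
          rintro ⟨hlt, -⟩; simp at hlt
        show φ (F.coeff (Finsupp.single 0 μ)) * _ * _ = 0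
        rw [notMem_support_iff.mp hns, map_zero, zero_mul, zero_mul]
      rw [h0, sub_zero]
      refine Ideal.sum_mem _ fun m hm => hothers m hm ?_
      rintro rfl; exact hμ0 hm
  -- assembling: `φ(F(c)) − (φ u₁)^μ F⋆(c′) ∈ F′_T`
  have hmain : φ (eval c F) - φ (c 1) ^ μ * eval c' Fst ∈ weightedIdealW c' w' T := by
    rw [hφF, ← Finset.sum_filter_add_sum_filter_not F.support face,
      ← Finset.sum_fiberwise_of_maps_to hmaps]
    simp_rw [hfib]
    rw [hFst, map_add, map_sum, mul_add, Finset.mul_sum]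
    have : (∑ b ∈ Bs, ∑ m ∈ faceSet F μ δs b, term m) + (∑ m ∈ F.support.filter (fun m => ¬ face m), term m) -
        ((∑ b ∈ Bs, φ (c 1) ^ μ * eval c' (if val b = mstar then monomial (eOf b) (vOf b) else 0)) +
          φ (c 1) ^ μ * eval c' (monomial (Finsupp.single 0 μ) (φ (F.coeff (Finsupp.single 0 μ))))) =
        (∑ b ∈ Bs, ((∑ m ∈ faceSet F μ δs b, term m) -
          φ (c 1) ^ μ * eval c' (if val b = mstar then monomial (eOf b) (vOf b) else 0))) +
        ((∑ m ∈ F.support.filter (fun m => ¬ face m), term m) -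
          φ (c 1) ^ μ * eval c' (monomial (Finsupp.single 0 μ) (φ (F.coeff (Finsupp.single 0 μ))))) := by
      rw [Finset.sum_sub_distrib]; ring
    rw [this]
    exact Ideal.add_mem _ (Ideal.sum_mem _ fun b hb => hP2 b hb) hP1
  -- the remainder
  have hrem' : φ (f - eval c F) ∈ weightedIdealW c' w' T := by
    have h1 := map_pow_maximalIdeal_le_span φ (c' := ![c' 0, c' 1, t]) (by simpa using h₀)
      (by simpa using ht) hgen M (Ideal.mem_map_of_mem _ hFrem)
    obtain ⟨r, hr⟩ := Ideal.mem_span_singleton'.mp h1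
    rw [← hr]
    have hmon : φ (c 1) ^ M = monom3 c' (Finsupp.single 1 M) := by simp [monom3, h₁]
    rw [hmon, ← mul_one (r * monom3 c' (Finsupp.single 1 M))]
    refine hmon_mem _ _ _ ?_
    rw [Finsupp.weight_apply, Finsupp.sum_single_index (by simp), smul_eq_mul, hT, hℓ]
    simp only [hw'def, levelWeight_one]
    have hℓΛ : w0' * μ ≤ Λ := by
      rw [hw0', hΛ]
      refine Nat.mul_le_mul_right _ ?_
      have : Ntil * (δs - μ.factorial) ≤ Ntil * δs := Nat.mul_le_mul_left _ (Nat.sub_le _ _)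
      omega
    have h2 : M * (μ.factorial * Ntil) = Λ * (μ.factorial * Ntil) + μ * (μ.factorial * Ntil) + μ.factorial * Ntil := by
      rw [hM]; ring
    rw [h2]
    have h3 : Λ ≤ Λ * (μ.factorial * Ntil) :=
      Nat.le_mul_of_pos_right _ (Nat.mul_pos (Nat.factorial_pos μ) (by omega))
    have h4 : 1 ≤ μ.factorial * Ntil := Nat.mul_pos (Nat.factorial_pos μ) (by omega)
    omega
  -- dividing by `(φ u₁)^μ`
  have hdiv : g - eval c' Fst ∈ weightedIdealW c' w' (ℓ + 1) := by
    have htot : φ (c 1) ^ μ * (g - eval c' Fst) ∈ weightedIdealW c' w' T := by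
      have : φ (c 1) ^ μ * (g - eval c' Fst) =
          (φ (eval c F) - φ (c 1) ^ μ * eval c' Fst) + φ (f - eval c F) := by
        rw [map_sub, mul_sub, ← hg]; ring
      rw [this]; exact Ideal.add_mem _ hmain hrem'
    have hmon : φ (c 1) ^ μ = monom3 c' (Finsupp.single 1 μ) := by simp [monom3, h₁]
    have hwt1 : Finsupp.weight w' (Finsupp.single 1 μ) = μ * (μ.factorial * Ntil) := by
      rw [Finsupp.weight_apply, Finsupp.sum_single_index (by simp), smul_eq_mul]
      simp [hw'def]
    refine mem_weightedIdealW_of_monom3_mul_mem c' hgen' hdim' hw' (Finsupp.single 1 μ) ?_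
    rw [hwt1, ← hmon, ← hT]; exact htot
  -- conclusion
  have hinit : IsInitialTerm c' w' g (eOf bst) := by
    refine ⟨Fst, ?_, ?_, ?_⟩
    · rw [hweOf_eq bst hbst hmstar.symm]; exact hFst_hom
    · rw [hFst_coeff]; exact hvOf bst hbst
    · rw [hweOf_eq bst hbst hmstar.symm]; exact hdiv
  refine ⟨eOf bst, ⟨mem_occ_of_isInitialTerm c' hgJ' hw' hinit, by simpa [eOf] using hbst_lt⟩, ?_, ?_⟩
  · -- `spt₁ + L = δs`
    have h1 := haOf bst hbst
    have hsf : sfac μ (eOf bst) = sfac μ (mOf bst) := by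
      rw [sfac, sfac, (mem_faceSet.mp (hmOf bst hbst)).2.1]; rfl
    have hLb := hL (mem_faceSet.mp (hmOf bst hbst)).2.2.1
    rw [(mem_faceSet.mp (hmOf bst hbst)).2.1] at hLb
    rw [spt₁, hsf]
    show aOf bst * sfac μ (mOf bst) + μ.factorial = δs
    have hpos : 0 < μ - bst := by omega
    have key : (μ - bst) * (aOf bst * sfac μ (mOf bst)) = (μ - bst) * (δs - μ.factorial) := by
      rw [← h1, ← hLb]; ring
    have := Nat.eq_of_mul_eq_mul_left hpos key
    omega
  · -- `d · spt₂ ≤ Γ`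
    have := hvalΓd bst hbst
    have hsf : sfac μ (eOf bst) = μ.factorial / (μ - bst) := by rw [sfac]; rfl
    rw [spt₂, hsf]
    exact this

include h₁ h₀ ht hP hgen hdim hgen' hdim' hres in
/-- **The laws at a non-rational point** (CoP1 Lemma 4.5 (2), hard part; CJS Lemma 14.5 for the
system `(y′, u₁, φ′)`): `α′ + L = δs` and `d · β′ ≤ γ⁺s`. Consequently `d · β′ ≤ βs` and, when
`d ≥ 2` and `βs > 0`, `β′ < βs`. [cite: CossartPiltant2008, Lemma 4.5 (2), (22)] [cite: CossartJannsenSaito2020, Lemma 14.5] -/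
theorem alphaS_nr_add_and_mul_betaS_le (hPu : ¬ IsUnit (Polynomial.map (residue R) P))
    (hd : 1 ≤ (Polynomial.map (residue R) P).natDegree)
    (hJμ : J ≤ maximalIdeal R ^ μ) (hne : (pts c J μ).Nonempty) (hδ : μ.factorial < deltaS c J μ) :
    (pts c' J' μ).Nonempty ∧ alphaS c' J' μ + μ.factorial = deltaS c J μ ∧
      (Polynomial.map (residue R) P).natDegree * betaS c' J' μ ≤ gammaPlusS c J μ := by
  obtain ⟨e', he', h1, h2⟩ := exists_pts_nr_face φ h₁ h₀ ht hP hgen hdim hgen' hdim' hres hPu hd hJμ hne hδ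
  have hne' : (pts c' J' μ).Nonempty := ⟨e', he'⟩
  have hlow : ∀ x ∈ pts c' J' μ, deltaS c J μ ≤ spt₁ μ x + μ.factorial := fun x hx =>
    deltaS_le_spt₁_nr_add φ h₁ h₀ ht hgen hdim hgen' hdim' hδ hx
  have hα : alphaS c' J' μ + μ.factorial = deltaS c J μ := by
    refine le_antisymm ?_ ?_
    · have := alphaS_le he'; omega
    · obtain ⟨a, ha, ha1⟩ := exists_pts_alphaS hne'
      have := hlow a ha; rw [ha1] at this; exact this
  refine ⟨hne', hα, ?_⟩
  have hβ : betaS c' J' μ ≤ spt₂ μ e' := betaS_le he' (by omega)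
  exact (Nat.mul_le_mul_left _ hβ).trans h2

end Realize
end Literature.AlgebraicGeometry.Resolution
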